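import Summits.CriticalPhenomena.PercolationContinuityZ3.Theorems.PercNearOneGluingNoHeavyLowerTailCSHPsiDefs
import Summits.CriticalPhenomena.PercolationContinuityZ3.Theorems.PercNearOneGluingNoHeavyLowerTailCSHLemmaT
import HarnessLib

/-!
# Pinned hierarchy (PIN-CSH) — LEMMA T_ψ (the Gibbs-sampler reduction of a pinned margin to its world-wise form)

Support file (`--supports stmt-CriticalPhenomena-4575`), route task `nh-dp-fatminority` (line fat-minority-linear, gen 16); memo
`run/shared/lean/prim/prim-nh-dp-fatminority/CSH-PSI-MEMO.md` §2 (Lemma T_ψ).  First brick of the Lean proof of memo THEOREM 1_ψ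
(`PinCSH.Holds` for all data), whose consumers `PinCSH.preMargin_nonneg_of_pin` / `PinCSH.refined_margin_nonneg_of_pin` /
`PinCSH.question7_refined_of_pin` (the event-refined pre-FKG inequality (41)_E, UT4 for every number of ports, QS) are in the tree
conditional on it.  No definitions, no named facts, no sorries.

Lemma T_ψ (memo §2): the pinned margin `PinCSH.pMargin` — the cell's level-form margin `CSH.cshMarg` of the pinned decoy list and
observers' constant applied to the row `u ↦ cov_D(f(C_x), 1{x ↔ u})` (`u` a vertex) whose entry at the LABEL `o` is
`cov_D(f(C_x), ψ(C_x))` with the pinned test `ψ(C_x) = 1{x ↔ o}·1{C_x ∈ 𝓗}` (`PinCSH.pinEv`) — is nonnegative for every monotone `f`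
as soon as its WORLD-WISE version is nonnegative for every monotone `g ≥ 0` (worlds `w^ω` = `w` zeroed on the pairs meeting the open
vertex cluster of `Y`, vdBHK Lemma 2.4; in the world the entry at `u ≠ o` is `Cov_{w^ω}(g(C_x), 1{x ↔ u})` and the entry at `o` is
`Cov_{w^ω}(g(C_x), 1_{pinEv o 𝓗 x})`).  The point (memo §2, "the ψ-row is σ(C_x)-measurable like every other row"): the pinned
test is a function of the open edge cluster of `x` (`x ↔ o` iff `o = x` or an edge of `C_x` contains `o`), so the tree's reduction
theorem for an ARBITRARY test function of `C_x`, `BHK2006_clusterConditionalCov_nonneg_of_within` (Literature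
`TwoClusterGibbsCovariance`), applies to `h = Σ_u Λ(u)·τ_u(C_x)` with the coefficients `Λ(u) = Marg[δ_u]` of the margin
(`CSH.cshMarg_eq_sum`).  We first record the bookkeeping for an arbitrary family of events read on the edge cluster
(`eventRows_nonneg_of_within`), then specialise to the pinned rows (`pMargin_nonneg_of_within`).
[cite: VandenbergHaggstromKahn2005, §2.1 pp. 10–13, Lemma 2.4 (p. 10)] [cite: KozmaNitzan2024, Conj. 4 (p. 32), Question 7 (p. 36)]
-/

noncomputable section

namespace Summit.CriticalPhenomena.PercolationContinuityZ3.Theorems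

open MeasureTheory Set Literature.Probability.LatticeModels Literature.Probability.Percolation
open scoped Classical
open BHK2006

namespace PinCSH

variable {V : Type*} [Fintype V]

/-! ### Integrals against a finite combination of indicators -/

/-- `∫_D G · (Σ_u c(u)·1_{E_u}) = Σ_u c(u)·∫_{D ∩ E_u} G`. [folklore] -/
private theorem setIntegral_mul_sum_indicator (μ : Measure (BondConfig V)) [IsFiniteMeasure μ] (D : Set (BondConfig V))
    (T : Finset V) (c : V → ℝ) (E : V → Set (BondConfig V)) (G : BondConfig V → ℝ) :
    ∫ ω in D, G ω * (∑ u ∈ T, c u * (E u).indicator 1 ω) ∂μ = ∑ u ∈ T, c u * ∫ ω in D ∩ E u, G ω ∂μ := by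
  have e1 : (fun ω => G ω * (∑ u ∈ T, c u * (E u).indicator (1 : BondConfig V → ℝ) ω)) =
      fun ω => ∑ u ∈ T, c u * (E u).indicator G ω := by
    funext ω
    rw [Finset.mul_sum]
    refine Finset.sum_congr rfl fun u _ => ?_
    by_cases hω : ω ∈ E u
    · rw [indicator_of_mem hω, indicator_of_mem hω, Pi.one_apply]; ring
    · rw [indicator_of_notMem hω, indicator_of_notMem hω]; ring
  rw [e1, integral_finsetSum _ fun u _ => Integrable.of_finite]
  refine Finset.sum_congr rfl fun u _ => ?_
  rw [integral_const_mul, setIntegral_indicator (MeasurableSet.of_discrete)]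

/-- `∫ G · (Σ_u c(u)·1_{E_u}) = Σ_u c(u)·∫_{E_u} G`. [folklore] -/
private theorem integral_mul_sum_indicator (μ : Measure (BondConfig V)) [IsFiniteMeasure μ]
    (T : Finset V) (c : V → ℝ) (E : V → Set (BondConfig V)) (G : BondConfig V → ℝ) :
    ∫ ω, G ω * (∑ u ∈ T, c u * (E u).indicator 1 ω) ∂μ = ∑ u ∈ T, c u * ∫ ω in E u, G ω ∂μ := by
  have h := setIntegral_mul_sum_indicator μ univ T c E G
  simp only [Measure.restrict_univ, univ_inter] at h
  exact h

/-! ### The reduction for an arbitrary family of events read on the edge cluster -/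

/-- **Reduction theorem for a finite combination of cluster events.**  Source `s`, avoided set `X` with `w e < 1` on the non-loop
pairs meeting `X`, `D = {s ↮ X}`; a finite family of events `E_u` which are READ ON THE OPEN EDGE CLUSTER of `s`
(`τ_u(C_s(η)) = 1_{E_u}(η)`), coefficients `c(u)`.  If for every monotone `g ≥ 0` the world-wise combination
`∫_D Σ_u c(u)·[∫_{E_u} g(C_s) dμ_{w^ω} − (∫ g(C_s) dμ_{w^ω})·μ_{w^ω}(E_u)] dμ_w(ω) ≥ 0` (`w^ω` = `w` zeroed on the pairs meeting
the open vertex cluster of `X`), then for every monotone `f`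
`0 ≤ Σ_u c(u)·[μ(D)·∫_{D ∩ E_u} f(C_s) − (∫_D f(C_s))·μ(D ∩ E_u)]`.
(`BHK2006_clusterConditionalCov_nonneg_of_within` for `h = Σ_u c(u) τ_u`; the multi-marker form is `E_u = {s ↔ u}`.)
[cite: VandenbergHaggstromKahn2005, §2.1 pp. 10–13 (the chain) and Lemma 2.4 (p. 10) — corollary] -/
theorem eventRows_nonneg_of_within (w : Sym2 V → unitInterval) (s : V) (X : Set V)
    (hX : ∀ e : Sym2 V, ¬ e.IsDiag → (∃ v ∈ e, v ∈ X) → (w e : ℝ) < 1) (T : Finset V) (c : V → ℝ)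
    (E : V → Set (BondConfig V)) (τ : V → Set (Sym2 V) → ℝ)
    (hτ : ∀ u (η : BondConfig V), τ u (openEdgeCluster η s) = (E u).indicator 1 η)
    (hR : ∀ g : Set (Sym2 V) → ℝ, Monotone g → (∀ C, 0 ≤ g C) →
      0 ≤ ∫ ω in {ω : BondConfig V | ∀ x ∈ X, ¬ (openGraph ω).Reachable s x},
        (∑ u ∈ T, c u * ((∫ η in E u, g (openEdgeCluster η s)
                ∂(prodBernoulli fun e => if (∃ v ∈ e, ∃ x ∈ X, (openGraph ω).Reachable x v)
                  then (0 : unitInterval) else w e)) -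
              (∫ η, g (openEdgeCluster η s)
                ∂(prodBernoulli fun e => if (∃ v ∈ e, ∃ x ∈ X, (openGraph ω).Reachable x v)
                  then (0 : unitInterval) else w e)) *
              (prodBernoulli fun e => if (∃ v ∈ e, ∃ x ∈ X, (openGraph ω).Reachable x v)
                  then (0 : unitInterval) else w e).real (E u)))
        ∂(prodBernoulli w))
    (f : Set (Sym2 V) → ℝ) (hf : Monotone f) :
    0 ≤ ∑ u ∈ T, c u *
        ((prodBernoulli w).real {ω : BondConfig V | ∀ x ∈ X, ¬ (openGraph ω).Reachable s x} *
            (∫ ω in {ω : BondConfig V | ∀ x ∈ X, ¬ (openGraph ω).Reachable s x} ∩ E u,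
              f (openEdgeCluster ω s) ∂(prodBernoulli w)) -
          (∫ ω in {ω : BondConfig V | ∀ x ∈ X, ¬ (openGraph ω).Reachable s x},
              f (openEdgeCluster ω s) ∂(prodBernoulli w)) *
            (prodBernoulli w).real ({ω : BondConfig V | ∀ x ∈ X, ¬ (openGraph ω).Reachable s x} ∩ E u)) := by
  set μ := prodBernoulli w with hμ
  set D : Set (BondConfig V) := {ω | ∀ x ∈ X, ¬ (openGraph ω).Reachable s x} with hDdef
  set H : Set (Sym2 V) → ℝ := fun C => ∑ u ∈ T, c u * τ u C with hH
  have hHω : ∀ η : BondConfig V, H (openEdgeCluster η s) = ∑ u ∈ T, c u * (E u).indicator 1 η := fun η => by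
    simp only [hH, hτ]
  -- the fresh-configuration side, world by world
  have fresh : ∀ (g : Set (Sym2 V) → ℝ) (ω : BondConfig V),
      ((∫ η, g (openEdgeCluster (η \ {e | ∃ v ∈ e, ∃ x ∈ X, (openGraph ω).Reachable x v}) s) *
            H (openEdgeCluster (η \ {e | ∃ v ∈ e, ∃ x ∈ X, (openGraph ω).Reachable x v}) s) ∂μ) -
        (∫ η, g (openEdgeCluster (η \ {e | ∃ v ∈ e, ∃ x ∈ X, (openGraph ω).Reachable x v}) s) ∂μ) *
        (∫ η, H (openEdgeCluster (η \ {e | ∃ v ∈ e, ∃ x ∈ X, (openGraph ω).Reachable x v}) s) ∂μ)) =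
      ∑ u ∈ T, c u * ((∫ η in E u, g (openEdgeCluster η s)
              ∂(prodBernoulli fun e => if (∃ v ∈ e, ∃ x ∈ X, (openGraph ω).Reachable x v)
                then (0 : unitInterval) else w e)) -
            (∫ η, g (openEdgeCluster η s)
              ∂(prodBernoulli fun e => if (∃ v ∈ e, ∃ x ∈ X, (openGraph ω).Reachable x v)
                then (0 : unitInterval) else w e)) *
            (prodBernoulli fun e => if (∃ v ∈ e, ∃ x ∈ X, (openGraph ω).Reachable x v)
                then (0 : unitInterval) else w e).real (E u)) := by
    intro g ω
    set wX : Sym2 V → unitInterval := fun e => if (∃ v ∈ e, ∃ x ∈ X, (openGraph ω).Reachable x v)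
      then (0 : unitInterval) else w e with hwX
    have h0 : ∀ e ∈ {e : Sym2 V | ∃ v ∈ e, ∃ x ∈ X, (openGraph ω).Reachable x v}, wX e = 0 :=
      fun e he => by simp only [hwX]; exact if_pos he
    have h1 : ∀ e ∉ {e : Sym2 V | ∃ v ∈ e, ∃ x ∈ X, (openGraph ω).Reachable x v}, wX e = w e :=
      fun e he => by simp only [hwX]; exact if_neg he
    have splitU : ∀ G : BondConfig V → ℝ, ∫ η, G η * H (openEdgeCluster η s) ∂(prodBernoulli wX) =
        ∑ u ∈ T, c u * (∫ η in E u, G η ∂(prodBernoulli wX)) := by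
      intro G
      simp only [hHω]
      exact integral_mul_sum_indicator _ T c E G
    have massU : ∫ η, H (openEdgeCluster η s) ∂(prodBernoulli wX) = ∑ u ∈ T, c u * (prodBernoulli wX).real (E u) := by
      have h2 := splitU (fun _ => (1 : ℝ))
      simp only [one_mul] at h2
      rw [h2]
      exact Finset.sum_congr rfl fun u _ => by rw [setIntegral_const, smul_eq_mul, mul_one]
    rw [hμ, integral_comp_sdiff_prodBernoulli' w wX _ h0 h1
        (fun η => g (openEdgeCluster η s) * H (openEdgeCluster η s)),
      integral_comp_sdiff_prodBernoulli' w wX _ h0 h1 (fun η => g (openEdgeCluster η s)),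
      integral_comp_sdiff_prodBernoulli' w wX _ h0 h1 (fun η => H (openEdgeCluster η s)),
      splitU, massU, Finset.mul_sum, ← Finset.sum_sub_distrib]
    exact Finset.sum_congr rfl fun u _ => by ring
  -- the conclusion side
  have concl : μ.real D * (∫ ω in D, f (openEdgeCluster ω s) * H (openEdgeCluster ω s) ∂μ) -
      (∫ ω in D, f (openEdgeCluster ω s) ∂μ) * (∫ ω in D, H (openEdgeCluster ω s) ∂μ) =
      ∑ u ∈ T, c u * (μ.real D * (∫ ω in D ∩ E u, f (openEdgeCluster ω s) ∂μ) -
        (∫ ω in D, f (openEdgeCluster ω s) ∂μ) * μ.real (D ∩ E u)) := by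
    have split : ∀ G : BondConfig V → ℝ, ∫ ω in D, G ω * H (openEdgeCluster ω s) ∂μ =
        ∑ u ∈ T, c u * (∫ ω in D ∩ E u, G ω ∂μ) := by
      intro G
      simp only [hHω]
      exact setIntegral_mul_sum_indicator μ D T c E G
    have massD : ∫ ω in D, H (openEdgeCluster ω s) ∂μ = ∑ u ∈ T, c u * μ.real (D ∩ E u) := by
      have h2 := split (fun _ => (1 : ℝ))
      simp only [one_mul] at h2
      rw [h2]
      exact Finset.sum_congr rfl fun u _ => by rw [setIntegral_const, smul_eq_mul, mul_one]
    rw [split, massD, Finset.mul_sum, Finset.mul_sum, ← Finset.sum_sub_distrib]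
    exact Finset.sum_congr rfl fun u _ => by ring
  have main := BHK2006_clusterConditionalCov_nonneg_of_within w s X hX H (fun g hg hg0 => by
    have h := hR g hg hg0
    have e : ∀ ω : BondConfig V, _ = _ := fun ω => fresh g ω
    simp only [← e] at h
    exact h) f hf
  rw [← hμ] at main
  change 0 ≤ μ.real D * (∫ ω in D, f (openEdgeCluster ω s) * H (openEdgeCluster ω s) ∂μ) -
      (∫ ω in D, f (openEdgeCluster ω s) ∂μ) * (∫ ω in D, H (openEdgeCluster ω s) ∂μ) at main
  rw [concl] at main
  exact main

/-! ### The pinned rows read on the edge cluster -/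

/-- The vertex test read on the edge cluster: `1{u = x ∨ u ∈ V(C_x)} = 1_{x ↔ u}`. [cite: VandenbergHaggstromKahn2005, §1 p. 3] -/
theorem vertexRow_openEdgeCluster (x u : V) (η : BondConfig V) :
    (if (u = x ∨ ∃ e ∈ openEdgeCluster η x, u ∈ e) then (1 : ℝ) else 0) =
      (openConn x u : Set (BondConfig V)).indicator 1 η :=
  ite_mem_openEdgeCluster_eq_indicator η x u

/-- **The pinned test is read on the edge cluster**: `1{(o = x ∨ o ∈ V(C_x)) ∧ C_x ∈ 𝓗} = 1_{pinEv o 𝓗 x}` (memo §2: the ψ-row is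
`σ(C_x)`-measurable). [folklore] -/
theorem pinnedRow_openEdgeCluster (o : V) (𝓗 : Set (Set (Sym2 V))) (x : V) (η : BondConfig V) :
    (if ((o = x ∨ ∃ e ∈ openEdgeCluster η x, o ∈ e) ∧ openEdgeCluster η x ∈ 𝓗) then (1 : ℝ) else 0) =
      (pinEv o 𝓗 x).indicator 1 η := by
  by_cases h : η ∈ pinEv o 𝓗 x
  · rw [indicator_of_mem h, Pi.one_apply, if_pos]
    exact ⟨(reachable_iff_exists_mem_openEdgeCluster η x o).1 h.1, h.2⟩
  · rw [indicator_of_notMem h, if_neg]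
    rintro ⟨h1, h2⟩
    exact h ⟨(reachable_iff_exists_mem_openEdgeCluster η x o).2 h1, h2⟩

/-- The pinned row family read on the edge cluster. [folklore] -/
theorem pinRows_openEdgeCluster (o : V) (𝓗 : Set (Set (Sym2 V))) (x u : V) (η : BondConfig V) :
    (fun (u : V) (C : Set (Sym2 V)) => if u = o then
        (if ((o = x ∨ ∃ e ∈ C, o ∈ e) ∧ C ∈ 𝓗) then (1 : ℝ) else 0)
      else (if (u = x ∨ ∃ e ∈ C, u ∈ e) then (1 : ℝ) else 0)) u (openEdgeCluster η x) =
      ((fun u => if u = o then pinEv o 𝓗 x else (openConn x u : Set (BondConfig V))) u).indicator 1 η := by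
  by_cases hu : u = o
  · simp only [hu, if_true]
    exact pinnedRow_openEdgeCluster o 𝓗 x η
  · simp only [hu, if_false]
    exact vertexRow_openEdgeCluster x u η

/-! ### Lemma T_ψ -/

omit [Fintype V] in
/-- The pinned covariance row is the row of the event family `u ↦ (u = o ? pinEv o 𝓗 x : {x ↔ u})`. [folklore] -/
theorem pCovD_eq_event (w : Sym2 V → unitInterval) (o : V) (𝓗 : Set (Set (Sym2 V))) (x : V) (Y : Set V)
    (f : Set (Sym2 V) → ℝ) (u : V) :
    pCovD w o 𝓗 x Y f u =
      (prodBernoulli w).real {ω : BondConfig V | ∀ y ∈ Y, ¬ (openGraph ω).Reachable x y} *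
          (∫ ω in {ω : BondConfig V | ∀ y ∈ Y, ¬ (openGraph ω).Reachable x y} ∩
              (if u = o then pinEv o 𝓗 x else (openConn x u : Set (BondConfig V))),
            f (openEdgeCluster ω x) ∂(prodBernoulli w)) -
        (∫ ω in {ω : BondConfig V | ∀ y ∈ Y, ¬ (openGraph ω).Reachable x y}, f (openEdgeCluster ω x) ∂(prodBernoulli w)) *
          (prodBernoulli w).real ({ω : BondConfig V | ∀ y ∈ Y, ¬ (openGraph ω).Reachable x y} ∩
            (if u = o then pinEv o 𝓗 x else (openConn x u : Set (BondConfig V)))) := by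
  unfold pCovD
  by_cases hu : u = o
  · simp only [hu, if_true]
  · simp only [hu, if_false, CSH.covD]

/-- **Lemma T_ψ for the pinned hierarchy (fixed weights)** — memo CSH-PSI-MEMO §2.  Owner `x`, avoided set `Y` with `w e < 1` on the
non-loop pairs meeting `Y`, decoys `D`, label `o` with the upper family `𝓗`, second observer `v`; `L`, `p` the pinned decoy list and
observers' constant of `PinCSH.pMargin`.  IF for every monotone `g ≥ 0` the WORLD-WISE pinned margin is nonnegative,
`0 ≤ ∫_{x↮Y} Marg_{L,p}[W^ω_g] dμ_w(ω)`, where in the world `ω` (weights `w^ω` = `w` zeroed on the pairs meeting the open vertex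
cluster of `Y`) the entry at a vertex `u ≠ o` is `∫_{x↔u} g(C_x) dμ_{w^ω} − (∫ g(C_x) dμ_{w^ω})·μ_{w^ω}(x↔u)` and the entry at the label
`o` is `∫_{pinEv o 𝓗 x} g(C_x) dμ_{w^ω} − (∫ g(C_x) dμ_{w^ω})·μ_{w^ω}(pinEv o 𝓗 x)`, THEN `0 ≤ PinCSH.pMargin w o 𝓗 x Y D v f` for every
monotone `f`. [cite: VandenbergHaggstromKahn2005, §2.1 pp. 10–13, Lemma 2.4 (p. 10)] [cite: KozmaNitzan2024, Question 7 (p. 36)] -/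
theorem pMargin_nonneg_of_within (w : Sym2 V → unitInterval) (o : V) (𝓗 : Set (Set (Sym2 V))) (x : V) (Y : Set V)
    (D : List V) (v : V)
    (hY : ∀ e : Sym2 V, ¬ e.IsDiag → (∃ u ∈ e, u ∈ Y) → (w e : ℝ) < 1)
    (hW : ∀ g : Set (Sym2 V) → ℝ, Monotone g → (∀ C, 0 ≤ g C) →
      0 ≤ ∫ ω in {ω : BondConfig V | ∀ y ∈ Y, ¬ (openGraph ω).Reachable x y},
        CSH.cshMarg (pDecoyList w o 𝓗 (insert x Y) D) (pObsConst w o 𝓗 v (insert x Y ∪ {d | d ∈ D})) o v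
          (fun u => if u = o then
              (∫ η in pinEv o 𝓗 x, g (openEdgeCluster η x)
                  ∂(prodBernoulli fun e => if (∃ z ∈ e, ∃ y ∈ Y, (openGraph ω).Reachable y z)
                    then (0 : unitInterval) else w e)) -
                (∫ η, g (openEdgeCluster η x)
                  ∂(prodBernoulli fun e => if (∃ z ∈ e, ∃ y ∈ Y, (openGraph ω).Reachable y z)
                    then (0 : unitInterval) else w e)) *
                (prodBernoulli fun e => if (∃ z ∈ e, ∃ y ∈ Y, (openGraph ω).Reachable y z)
                    then (0 : unitInterval) else w e).real (pinEv o 𝓗 x)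
            else
              (∫ η in (openConn x u : Set (BondConfig V)), g (openEdgeCluster η x)
                  ∂(prodBernoulli fun e => if (∃ z ∈ e, ∃ y ∈ Y, (openGraph ω).Reachable y z)
                    then (0 : unitInterval) else w e)) -
                (∫ η, g (openEdgeCluster η x)
                  ∂(prodBernoulli fun e => if (∃ z ∈ e, ∃ y ∈ Y, (openGraph ω).Reachable y z)
                    then (0 : unitInterval) else w e)) *
                (prodBernoulli fun e => if (∃ z ∈ e, ∃ y ∈ Y, (openGraph ω).Reachable y z)
                    then (0 : unitInterval) else w e).real (openConn x u : Set (BondConfig V)))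
        ∂(prodBernoulli w))
    (f : Set (Sym2 V) → ℝ) (hf : Monotone f) :
    0 ≤ pMargin w o 𝓗 x Y D v f := by
  set L := pDecoyList w o 𝓗 (insert x Y) D with hL
  set p := pObsConst w o 𝓗 v (insert x Y ∪ {d | d ∈ D}) with hp
  set Λ : V → ℝ := fun u => CSH.cshMarg L p o v (Pi.single u 1) with hΛ
  set Ev : V → Set (BondConfig V) := fun u => if u = o then pinEv o 𝓗 x else (openConn x u : Set (BondConfig V)) with hEv
  -- the world row as the row of the event family `Ev`
  have hrow : ∀ (ω : BondConfig V) (g : Set (Sym2 V) → ℝ) (u : V),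
      (if u = o then
          (∫ η in pinEv o 𝓗 x, g (openEdgeCluster η x)
              ∂(prodBernoulli fun e => if (∃ z ∈ e, ∃ y ∈ Y, (openGraph ω).Reachable y z)
                then (0 : unitInterval) else w e)) -
            (∫ η, g (openEdgeCluster η x)
              ∂(prodBernoulli fun e => if (∃ z ∈ e, ∃ y ∈ Y, (openGraph ω).Reachable y z)
                then (0 : unitInterval) else w e)) *
            (prodBernoulli fun e => if (∃ z ∈ e, ∃ y ∈ Y, (openGraph ω).Reachable y z)
                then (0 : unitInterval) else w e).real (pinEv o 𝓗 x)
        else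
          (∫ η in (openConn x u : Set (BondConfig V)), g (openEdgeCluster η x)
              ∂(prodBernoulli fun e => if (∃ z ∈ e, ∃ y ∈ Y, (openGraph ω).Reachable y z)
                then (0 : unitInterval) else w e)) -
            (∫ η, g (openEdgeCluster η x)
              ∂(prodBernoulli fun e => if (∃ z ∈ e, ∃ y ∈ Y, (openGraph ω).Reachable y z)
                then (0 : unitInterval) else w e)) *
            (prodBernoulli fun e => if (∃ z ∈ e, ∃ y ∈ Y, (openGraph ω).Reachable y z)
                then (0 : unitInterval) else w e).real (openConn x u : Set (BondConfig V))) =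
      (∫ η in Ev u, g (openEdgeCluster η x)
          ∂(prodBernoulli fun e => if (∃ z ∈ e, ∃ y ∈ Y, (openGraph ω).Reachable y z)
            then (0 : unitInterval) else w e)) -
        (∫ η, g (openEdgeCluster η x)
          ∂(prodBernoulli fun e => if (∃ z ∈ e, ∃ y ∈ Y, (openGraph ω).Reachable y z)
            then (0 : unitInterval) else w e)) *
        (prodBernoulli fun e => if (∃ z ∈ e, ∃ y ∈ Y, (openGraph ω).Reachable y z)
            then (0 : unitInterval) else w e).real (Ev u) := by
    intro ω g u
    by_cases hu : u = o
    · simp only [hEv, hu, if_true]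
    · simp only [hEv, hu, if_false]
  have main := eventRows_nonneg_of_within w x Y hY Finset.univ Λ Ev
    (fun (u : V) (C : Set (Sym2 V)) => if u = o then
        (if ((o = x ∨ ∃ e ∈ C, o ∈ e) ∧ C ∈ 𝓗) then (1 : ℝ) else 0)
      else (if (u = x ∨ ∃ e ∈ C, u ∈ e) then (1 : ℝ) else 0))
    (fun u η => pinRows_openEdgeCluster o 𝓗 x u η)
    (fun g hg hg0 => by
      have h := hW g hg hg0
      have e : ∀ ω : BondConfig V, CSH.cshMarg L p o v
          (fun u => if u = o then
              (∫ η in pinEv o 𝓗 x, g (openEdgeCluster η x)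
                  ∂(prodBernoulli fun e => if (∃ z ∈ e, ∃ y ∈ Y, (openGraph ω).Reachable y z)
                    then (0 : unitInterval) else w e)) -
                (∫ η, g (openEdgeCluster η x)
                  ∂(prodBernoulli fun e => if (∃ z ∈ e, ∃ y ∈ Y, (openGraph ω).Reachable y z)
                    then (0 : unitInterval) else w e)) *
                (prodBernoulli fun e => if (∃ z ∈ e, ∃ y ∈ Y, (openGraph ω).Reachable y z)
                    then (0 : unitInterval) else w e).real (pinEv o 𝓗 x)
            else
              (∫ η in (openConn x u : Set (BondConfig V)), g (openEdgeCluster η x)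
                  ∂(prodBernoulli fun e => if (∃ z ∈ e, ∃ y ∈ Y, (openGraph ω).Reachable y z)
                    then (0 : unitInterval) else w e)) -
                (∫ η, g (openEdgeCluster η x)
                  ∂(prodBernoulli fun e => if (∃ z ∈ e, ∃ y ∈ Y, (openGraph ω).Reachable y z)
                    then (0 : unitInterval) else w e)) *
                (prodBernoulli fun e => if (∃ z ∈ e, ∃ y ∈ Y, (openGraph ω).Reachable y z)
                    then (0 : unitInterval) else w e).real (openConn x u : Set (BondConfig V))) =
        ∑ u ∈ Finset.univ, Λ u * ((∫ η in Ev u, g (openEdgeCluster η x)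
              ∂(prodBernoulli fun e => if (∃ z ∈ e, ∃ y ∈ Y, (openGraph ω).Reachable y z)
                then (0 : unitInterval) else w e)) -
            (∫ η, g (openEdgeCluster η x)
              ∂(prodBernoulli fun e => if (∃ z ∈ e, ∃ y ∈ Y, (openGraph ω).Reachable y z)
                then (0 : unitInterval) else w e)) *
            (prodBernoulli fun e => if (∃ z ∈ e, ∃ y ∈ Y, (openGraph ω).Reachable y z)
                then (0 : unitInterval) else w e).real (Ev u)) := by
        intro ω
        rw [CSH.cshMarg_eq_sum]
        exact Finset.sum_congr rfl fun u _ => by rw [hrow ω g u]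
      simp only [e] at h
      exact h) f hf
  have hconc : pMargin w o 𝓗 x Y D v f = ∑ u, Λ u * pCovD w o 𝓗 x Y f u := by
    rw [pMargin, ← hL, ← hp, CSH.cshMarg_eq_sum]
  rw [hconc]
  simp only [pCovD_eq_event, hEv] at main ⊢
  exact main

end PinCSH

end Summit.CriticalPhenomena.PercolationContinuityZ3.Theorems

end
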